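import Summits.CriticalPhenomena.CardyFormulaZ2.Theorems.CardyBoundaryCoulombGasHalfPlaneMarkDensityLawSubsequentialLimits

/-!
# `HalfPlaneMarkDensityLaw` (crux stmt-CriticalPhenomena-5661), line `Sketch`, dense positivity:
# stub `stub_lawSeq_frequently_ge_near_of` (P4') — near every fourth mark the lattice mark density is
# frequently bounded below

Pure glue (filters).  Given `a < b < c < x₀` and `ε > 0`: by precompactness
(`Subseq.exists_jointSubseqLimit` with `φ = id`) there are a strictly increasing `ψ` and a joint
subsequential limit `G` of `P_n(a,b,c,y) = P_{1/2}[[⌊an⌋,⌊bn⌋]×{0} ↔ [⌊cn⌋,⌊yn⌋]×{0} in ℤ×ℕ]` along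
`ψ`.  Hypothesis (P2) says `{x | c < x ∧ 0 < ∂₄G(a,b,c,x)}` is dense in `(c,∞)`, so it contains some
`x` with `|x − x₀| < ε` (`Metric.mem_closure_iff`).  Hypothesis (P3) at `x` gives `c₁ > 0` with
`c₁ ≤ lawSeq a b c x (ψ j)` eventually in `j`; since `ψ → ∞` (`StrictMono.tendsto_atTop`), the bound
`c₁ ≤ lawSeq a b c x n` holds frequently in `n` (`Filter.Eventually.frequently`,
`Filter.Tendsto.frequently`).
-/

noncomputable section

namespace Summit.CriticalPhenomena.CardyFormulaZ2.Cruxes.HalfPlaneMarkDensityLaw.SketchLine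

open Literature.Probability.Percolation Literature.Probability.LatticeModels
open MeasureTheory Filter Set
open scoped Topology
open Summit.CriticalPhenomena.CardyFormulaZ2.Theorems.HalfPlaneMarkDensityLaw.Negative

namespace DensePos

/-- STUB P4' (glue): P2 and P3 give P4 (`Subseq.exists_jointSubseqLimit`): **near every fourth mark
there are marks at which the lattice mark density is frequently bounded below.** [folklore] -/
theorem stub_lawSeq_frequently_ge_near_of :
    (∀ {θ : ℕ → ℕ} {G : ℝ → ℝ → ℝ → ℝ → ℝ},
      (∀ a b c y : ℝ, a < b → b < c → c < y →
        Tendsto (fun n ↦ μ.real (openCrossing halfPlane (arcA a b (θ n))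
          (rowIcc ⌊c * (θ n : ℕ)⌋ ⌊y * (θ n : ℕ)⌋))) atTop (𝓝 (G a b c y))) →
      StrictMono θ → ∀ {a b c : ℝ}, a < b → b < c →
        IsOpen {x | c < x ∧ 0 < deriv (G a b c) x} ∧ Ioi c ⊆ closure {x | c < x ∧ 0 < deriv (G a b c) x}) →
    (∀ {θ : ℕ → ℕ} {G : ℝ → ℝ → ℝ → ℝ → ℝ},
      (∀ a b c y : ℝ, a < b → b < c → c < y →
        Tendsto (fun n ↦ μ.real (openCrossing halfPlane (arcA a b (θ n))
          (rowIcc ⌊c * (θ n : ℕ)⌋ ⌊y * (θ n : ℕ)⌋))) atTop (𝓝 (G a b c y))) →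
      StrictMono θ → ∀ {a b c x : ℝ}, a < b → b < c → c < x → 0 < deriv (G a b c) x →
        ∃ c₁ : ℝ, 0 < c₁ ∧ ∀ᶠ j : ℕ in atTop, c₁ ≤ lawSeq a b c x (θ j)) →
    ∀ (a b c x₀ ε : ℝ), a < b → b < c → c < x₀ → 0 < ε →
      ∃ x : ℝ, |x - x₀| < ε ∧ c < x ∧ ∃ c₁ : ℝ, 0 < c₁ ∧ ∃ᶠ n : ℕ in atTop, c₁ ≤ lawSeq a b c x n := by
  intro hP2 hP3 a b c x₀ ε hab hbc hcx₀ hε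
  -- a joint subsequential limit `G` along some strictly increasing `ψ` (precompactness, `φ = id`)
  obtain ⟨ψ, hψ, G, hG⟩ := Subseq.exists_jointSubseqLimit id strictMono_id
  have hG' : ∀ a b c y : ℝ, a < b → b < c → c < y →
      Tendsto (fun n ↦ μ.real (openCrossing halfPlane (arcA a b (ψ n))
        (rowIcc ⌊c * (ψ n : ℕ)⌋ ⌊y * (ψ n : ℕ)⌋))) atTop (𝓝 (G a b c y)) := hG
  -- a mark `x` near `x₀` with `∂₄G(a,b,c,x) > 0` (density, P2)
  obtain ⟨-, hdense⟩ := hP2 hG' hψ hab hbc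
  obtain ⟨x, ⟨hcx, hdx⟩, hdist⟩ := Metric.mem_closure_iff.1 (hdense (mem_Ioi.2 hcx₀)) ε hε
  -- an eventual lower bound along `ψ` (P3), hence a frequent one along the full sequence
  obtain ⟨c₁, hc₁, hev⟩ := hP3 hG' hψ hab hbc hcx hdx
  refine ⟨x, ?_, hcx, c₁, hc₁, ?_⟩
  · rw [Real.dist_eq, abs_sub_comm] at hdist
    exact hdist
  · exact hψ.tendsto_atTop.frequently (p := fun n ↦ c₁ ≤ lawSeq a b c x n) hev.frequently

end DensePos

end Summit.CriticalPhenomena.CardyFormulaZ2.Cruxes.HalfPlaneMarkDensityLaw.SketchLine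

end
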